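import Summits.QuantumFields.YangMills.Theorems.LuscherReductionTwistedTraceScalingBOStiffDefs
import Summits.QuantumFields.YangMills.Theorems.LuscherReductionTwistedTraceScalingBOStiffBasedForm
import Summits.QuantumFields.YangMills.Theorems.LuscherReductionTwistedTraceScalingSlowDisintegrationTubes
import HarnessLib

/-!
# (B-ST) central-fibre DATA: the structural hypotheses of `hfib_of_door` / `kform_bilinear_bound` for the central objects `cM`, `cΘ`, `cS` of `…BOStiffDefs`
# (lane A of S-BASE, crux `TwistedTraceScaling` stmt-QuantumFields-20203, C4-CORE, the (B-ST) pen; HANDOFF-g21 UPDATE 21:10Z/21:40Z)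

No analysis, only bookkeeping that every (L-3) instance file would otherwise repeat:
★ `measurable_cM`, `cM_bounds` (`0 ≤ cM ≤ C`), `cM_symm`, ★★ `cM_psd` (`0 ≤ ∫∫ f·cM·f dπ dπ` for bounded measurable `f`, from ✓ `integral_integral_basedKernel_nonneg` with
`Ψ = orthoTube 1`), `measurable_cΘ`, `cΘ_mem_Icc` (`0 ≤ cΘ ≤ 1`), `cΘ_eq_zero_of_not_mem_cS`, `measurableSet_cS`; packaged as ★★ `central_kform_data`.
HONEST FRAMING: bookkeeping for a stub of a child of the CONDITIONAL route R2b1; (B-ST) OPEN; C4-CORE OPEN; not infinite volume, not a gap, not Clay.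
-/

set_option autoImplicit false

noncomputable section

open MeasureTheory

namespace Summit.QuantumFields.YangMills.Theorems.FemtoTransferGap.TwoLattice.ConstTube

open Literature.MathematicalPhysics.QuantumFieldTheory Literature.MathematicalPhysics.QuantumLattice TwoLattice.Avg TwoLattice.Stiff TwoLattice.GnChart TwoLattice.Cov

variable {L : ℕ} [NeZero L]

/-! ## §1 The central based kernel -/

/-- The 3-variable integrand `((x,x'),h) ↦ K_β(oT 1 x, (oT 1 x')^{bE h})` is measurable. [folklore] -/
theorem measurable_cM_integrand (β : ℝ) :
    Measurable fun p : ((Edge 3 L → Fin 3 → ℝ) × (Edge 3 L → Fin 3 → ℝ)) × (NzSite L → SU2) =>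
      transferKernel su2Rep β (orthoTube L 1 p.1.1) (gaugeTransform (basedExt L p.2) (orthoTube L 1 p.1.2)) := by
  have hK : Measurable fun q : GaugeConfig 3 L SU2 × GaugeConfig 3 L SU2 => transferKernel su2Rep β q.1 q.2 :=
    (continuous_transferKernel su2Rep continuous_su2Rep β).measurable
  have hoT : Measurable fun x : Edge 3 L → Fin 3 → ℝ => orthoTube L 1 x := measurable_orthoTube_right (L := L) 1
  have h1 : Measurable fun p : ((Edge 3 L → Fin 3 → ℝ) × (Edge 3 L → Fin 3 → ℝ)) × (NzSite L → SU2) => orthoTube L 1 p.1.1 := hoT.comp (measurable_fst.comp measurable_fst)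
  have h2a : Measurable fun p : ((Edge 3 L → Fin 3 → ℝ) × (Edge 3 L → Fin 3 → ℝ)) × (NzSite L → SU2) => (orthoTube L 1 p.1.2, basedExt L p.2) :=
    (hoT.comp (measurable_snd.comp measurable_fst)).prodMk ((measurable_basedExt L).comp measurable_snd)
  have h2 : Measurable fun p : ((Edge 3 L → Fin 3 → ℝ) × (Edge 3 L → Fin 3 → ℝ)) × (NzSite L → SU2) => gaugeTransform (basedExt L p.2) (orthoTube L 1 p.1.2) := by
    have h := (measurable_gaugeAction (L := L)).comp h2a; simpa only [Function.comp_def] using h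
  have h := hK.comp (h1.prodMk h2)
  simpa only [Function.comp_def] using h

/-- ★ `cM β` is jointly measurable. [folklore] -/
theorem measurable_cM (β : ℝ) : Measurable (Function.uncurry (cM L β)) := by
  have h := ((measurable_cM_integrand (L := L) β).stronglyMeasurable.integral_prod_right' (ν := basedMeasure L)).measurable
  have e : (Function.uncurry (cM L β)) = fun p : (Edge 3 L → Fin 3 → ℝ) × (Edge 3 L → Fin 3 → ℝ) =>
      ∫ h, transferKernel su2Rep β (orthoTube L 1 p.1) (gaugeTransform (basedExt L h) (orthoTube L 1 p.2)) ∂basedMeasure L := by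
    funext p; rfl
  rw [e]; exact h

/-- ★ `0 ≤ cM ≤ C`. [folklore] -/
theorem cM_bounds (β : ℝ) : ∃ C : ℝ, ∀ x x' : Edge 3 L → Fin 3 → ℝ, 0 ≤ cM L β x x' ∧ cM L β x x' ≤ C ∧ |cM L β x x'| ≤ C := by
  obtain ⟨C, hC⟩ := basedKernel_bounds (L := L) β
  refine ⟨C, fun x x' => ?_⟩
  obtain ⟨h0, h1⟩ := hC (orthoTube L 1 x) (orthoTube L 1 x')
  exact ⟨h0, h1, by unfold cM; rw [abs_of_nonneg h0]; exact h1⟩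

/-- ★ `cM` is symmetric. [folklore] -/
theorem cM_symm (β : ℝ) (x x' : Edge 3 L → Fin 3 → ℝ) : cM L β x x' = cM L β x' x := by
  unfold cM; exact basedKernel_symm β _ _

/-- ★★ `cM` is positive semi-definite on bounded measurable functions of the fibre (`β ≥ 0`). [cite: SeilerLNP1982, §3] -/
theorem cM_psd {β : ℝ} (hβ : 0 ≤ β) : ∀ f : (Edge 3 L → Fin 3 → ℝ) → ℝ, Measurable f → (∃ C : ℝ, ∀ x, |f x| ≤ C) →
    0 ≤ ∫ x, ∫ y, f x * cM L β x y * f y ∂orthoTransverse L ∂orthoTransverse L := by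
  intro f hf ⟨C, hC⟩
  haveI := isFiniteMeasure_orthoTransverse L
  have hoT : Measurable fun x : Edge 3 L → Fin 3 → ℝ => orthoTube L 1 x := measurable_orthoTube_right (L := L) 1
  exact integral_integral_basedKernel_nonneg (ν := orthoTransverse L) hβ hoT hf hC

/-! ## §2 The central profile and its support -/

/-- `cΩ β` is measurable. [folklore] -/
theorem measurable_cΩ (β : ℝ) : Measurable (cΩ L β) := by
  unfold cΩ
  exact measurable_capRestrict (L := L) (measurable_frozenProfile (fun β' => measurable_stiffGaussExp _ _) _ β)

/-- ★ `cΘ β` is measurable. [folklore] -/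
theorem measurable_cΘ (β : ℝ) : Measurable (cΘ L β) := (measurable_cΩ (L := L) β).comp (measurable_linkEmbed L)

/-- `0 ≤ cΩ ≤ 1`. [folklore] -/
theorem cΩ_mem_Icc (β : ℝ) (y : LinkSpace L) : 0 ≤ cΩ L β y ∧ cΩ L β y ≤ 1 := by
  have hF0 : ∀ x, 0 ≤ frozenProfile L (fun β' => stiffGaussExp L (β' / 2) β') (fun β' => min (1 / 40) (powScale (1 / 2) β' * btLog β')) β x :=
    fun x => (frozenProfile_mem_Icc (fun β' x => stiffGaussExp_nonneg _ _ x) _ β x).1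
  have hF1 : ∀ x, |frozenProfile L (fun β' => stiffGaussExp L (β' / 2) β') (fun β' => min (1 / 40) (powScale (1 / 2) β' * btLog β')) β x| ≤ 1 :=
    fun x => abs_frozenProfile_le (fun β' x => stiffGaussExp_nonneg _ _ x) _ β x
  obtain ⟨h0, -, h1⟩ := capRestrict_mem (L := L) hF0 hF1 y
  exact ⟨h0, (le_abs_self _).trans h1⟩

/-- ★ `0 ≤ cΘ ≤ 1`, `|cΘ| ≤ 1`. [folklore] -/
theorem cΘ_mem_Icc (β : ℝ) (x : Edge 3 L → Fin 3 → ℝ) : 0 ≤ cΘ L β x ∧ cΘ L β x ≤ 1 ∧ |cΘ L β x| ≤ 1 := by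
  obtain ⟨h0, h1⟩ := cΩ_mem_Icc (L := L) β (linkEmbed L x)
  exact ⟨h0, h1, by unfold cΘ; rw [abs_of_nonneg h0]; exact h1⟩

/-- `cΘ = 0` off `cS` (by definition). [folklore] -/
theorem cΘ_eq_zero_of_not_mem_cS (β : ℝ) (x : Edge 3 L → Fin 3 → ℝ) (hx : x ∉ cS L β) : cΘ L β x = 0 := by
  by_contra h; exact hx h

/-- `cS β` is measurable. [folklore] -/
theorem measurableSet_cS (β : ℝ) : MeasurableSet (cS L β) := by
  have h : cS L β = (cΘ L β) ⁻¹' {0}ᶜ := by ext x; simp [cS]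
  rw [h]; exact (measurable_cΘ (L := L) β) (MeasurableSet.singleton 0).compl

/-! ## §3 Package -/

/-- ★★ **Central kernel-form data** (`β ≥ 0`): joint measurability, a bound, symmetry and positive semi-definiteness of `cM`; measurability, `[0,1]`-valuedness and support of
`cΘ`; measurability of `cS` — the structural hypotheses of `StiffDoor.hfib_of_door` at the central fibre. [folklore] -/
theorem central_kform_data {β : ℝ} (hβ : 0 ≤ β) :
    Measurable (Function.uncurry (cM L β)) ∧ (∃ C : ℝ, ∀ x x', |cM L β x x'| ≤ C) ∧ (∀ x x', cM L β x x' = cM L β x' x) ∧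
    (∀ f : (Edge 3 L → Fin 3 → ℝ) → ℝ, Measurable f → (∃ C : ℝ, ∀ x, |f x| ≤ C) → 0 ≤ ∫ x, ∫ y, f x * cM L β x y * f y ∂orthoTransverse L ∂orthoTransverse L) ∧
    Measurable (cΘ L β) ∧ (∀ x, |cΘ L β x| ≤ 1) ∧ (∀ x, 0 ≤ cΘ L β x) ∧ (∀ x, x ∉ cS L β → cΘ L β x = 0) ∧ MeasurableSet (cS L β) := by
  obtain ⟨C, hC⟩ := cM_bounds (L := L) β
  exact ⟨measurable_cM β, ⟨C, fun x x' => (hC x x').2.2⟩, cM_symm β, cM_psd hβ, measurable_cΘ β, fun x => (cΘ_mem_Icc β x).2.2, fun x => (cΘ_mem_Icc β x).1,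
    cΘ_eq_zero_of_not_mem_cS β, measurableSet_cS β⟩

end Summit.QuantumFields.YangMills.Theorems.FemtoTransferGap.TwoLattice.ConstTube

end
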